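import Summits.AtomisticToContinuum.HydrodynamicLimit.Theorems.ImplosionDichotomyPolynomialCompressionCloseStep

/-!
# Scalar bookkeeping for the level-3 coefficient envelope (line `log-lipschitz-budget`, stub 4)

Helper file for the crux `ImplosionDichotomy.PolynomialCompression` (stmt-AtomisticToContinuum-12587), stub
`stub_logBudgetShadowing` (level-3 estimate), companion of `…Level3CoefficientEnvelope`: the pure real-number
facts behind `level3_coefficient_envelope`. With the absorbing constant `b = (1 + C_b)(1 + K + K⁻¹) R (1 + λ⁻¹)`
(`level3_envelope_absorb`) and `U = 2b²`: at a point of the weak bootstrap regime the density lies in `[U⁻¹, U]`,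
`|θ|, |∂ρ|, |∂θ| ≤ U`, the equation-of-state sizes `|ζ - 1|, |ζ'|, …, |ζ⁗|` are `≤ cZ σ³ U³` and `cZ σ³ ≤ U/8`
(`level3_envelope_point`); the Friedrichs weights `A, ρ, B` lie in `[Mv⁻¹, Mv]` with `√A + √ρ + √B ≤ Mv` once
`16 b³ ≤ Mv` (`level3_envelope_weights`, from `lbClose_point_facts`); and the explicit constants produced by
`shadow_atom_bounds` and the product rule are `≤ Mv` (the small ones `≤ cZ σ³ Mv`) once `2¹⁸ (1 + U)¹⁶ ≤ Mv`
(`level3_envelope_consts`).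
-/

noncomputable section

namespace Summit.AtomisticToContinuum.HydrodynamicLimit.Theorems

/-- `√y ≤ (1 + y)/2` for `y ≥ 0`. [folklore] -/
private theorem l3ce_sqrt_le {y : ℝ} (hy : 0 ≤ y) : Real.sqrt y ≤ (1 + y) / 2 := by
  nlinarith [Real.sq_sqrt hy, sq_nonneg (Real.sqrt y - 1), Real.sqrt_nonneg y]

/-- `1/√K ≤ 1 + K + K⁻¹` and `√K ≤ 1 + K + K⁻¹` for `K > 0`. [folklore] -/
private theorem l3ce_sqrtK {K : ℝ} (hK : 0 < K) :
    (Real.sqrt K)⁻¹ ≤ 1 + K + K⁻¹ ∧ Real.sqrt K ≤ 1 + K + K⁻¹ := by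
  have hKi : 0 < K⁻¹ := inv_pos.2 hK
  have h1 := l3ce_sqrt_le hK.le
  have h2 := l3ce_sqrt_le hKi.le
  rw [Real.sqrt_inv] at h2
  constructor <;> linarith

/-- `Mv⁻¹ ≤ a` from a positive lower bound `m ≤ a` with `m⁻¹ ≤ Mv`. [folklore] -/
private theorem l3ce_inv_le {a m Mv : ℝ} (hm : 0 < m) (hma : m ≤ a) (hMv : m⁻¹ ≤ Mv) : Mv⁻¹ ≤ a := by
  have h := inv_anti₀ (inv_pos.2 hm) hMv
  rw [inv_inv] at h
  exact h.trans hma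

/-- The weights at a point of the weak regime lie in `[Mv⁻¹, Mv]`, and `√A + √ρ + √B ≤ Mv`. [folklore] -/
theorem level3_envelope_weights {K R b Mv c r₁ t₁ r θ z dz : ℝ} (hK : 0 < K) (hR : 1 ≤ R)
    (hcl : R⁻¹ ≤ c) (hcu : c ≤ R) (hr₁ : r₁ = c ^ 3) (ht₁ : t₁ = K * c ^ 2)
    (hδr : |r - r₁| ≤ r₁ / 2) (hδt : |θ - t₁| ≤ t₁ / 2) (hz : |z - 1| ≤ 1 / 8) (hdz : |r * dz| ≤ 1 / 8)
    (hb1 : R ≤ b) (hb2 : K * R ≤ b) (hb3 : R / K ≤ b) (hMv : 16 * b ^ 3 ≤ Mv) :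
    Mv⁻¹ ≤ θ * (z + r * dz) / r ∧ θ * (z + r * dz) / r ≤ Mv ∧ Mv⁻¹ ≤ r ∧ r ≤ Mv ∧
      Mv⁻¹ ≤ 3 / 2 * r / θ ∧ 3 / 2 * r / θ ≤ Mv ∧
      Real.sqrt (θ * (z + r * dz) / r) + Real.sqrt r + Real.sqrt (3 / 2 * r / θ) ≤ Mv := by
  have hR0 : 0 < R := by linarith
  obtain ⟨h1, h2, h3, h4, h5⟩ :=
    lbClose_point_facts hK (inv_pos.2 hR0) hcl hcu hr₁ ht₁ hδr hδt hz hdz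
  have hb0 : 1 ≤ b := hR.trans hb1
  have hbb : b ≤ b ^ 3 := le_self_pow₀ hb0 (by norm_num)
  have hR3 : R ^ 3 ≤ b ^ 3 := pow_le_pow_left₀ hR0.le hb1 3
  have hc0 : 0 < c := (inv_pos.2 hR0).trans_le hcl
  have ht₁0 : 0 < t₁ := by rw [ht₁]; positivity
  have hθ1 : t₁ / 2 ≤ θ := by linarith [(abs_le.1 hδt).1]
  have hθ0 : 0 < θ := by linarith
  have hr2 : r ≤ 3 / 2 * c ^ 3 := by
    have h := (abs_le.1 hδr).2
    rw [hr₁] at h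
    linarith
  have hr0 : 0 < r := by
    have : 0 < R⁻¹ ^ 3 / 2 := by positivity
    linarith
  have hA0 : 0 < θ * (z + r * dz) / r := lt_of_lt_of_le (by positivity) h3
  have hMv0 : 0 ≤ Mv := by nlinarith
  -- `B ≤ (9/2)(c/K)`-type bound: `3/2 r ≤ X θ` whenever `9/4 c ≤ X K / 2`... done for two values of `X`
  have hcK : c / K ≤ b := (div_le_div_of_nonneg_right hcu hK.le).trans hb3
  have hBle : ∀ X : ℝ, 0 ≤ X → 9 / 2 * b ≤ X → 3 / 2 * r / θ ≤ X := by
    intro X hX0 hX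
    rw [div_le_iff₀ hθ0]
    have e0 : c ≤ K * b := by rwa [div_le_iff₀ hK, mul_comm] at hcK
    have e1 : c * c ^ 2 ≤ K * b * c ^ 2 := mul_le_mul_of_nonneg_right e0 (sq_nonneg c)
    have e2 : 9 / 2 * b * (K * c ^ 2 / 2) ≤ X * (K * c ^ 2 / 2) :=
      mul_le_mul_of_nonneg_right hX (by positivity)
    have e3 : X * (t₁ / 2) ≤ X * θ := mul_le_mul_of_nonneg_left hθ1 hX0
    rw [ht₁] at e3
    nlinarith [e1, e2, e3]
  have uA : θ * (z + r * dz) / r ≤ 4 * (K * R) := by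
    refine h4.trans (le_of_eq ?_)
    rw [div_inv_eq_mul]; ring
  refine ⟨?_, by linarith, ?_, by linarith, ?_, hBle Mv hMv0 (by linarith), ?_⟩
  · refine l3ce_inv_le (by positivity) h3 ?_
    rw [inv_div]
    have : 4 * R / K = 4 * (R / K) := by ring
    rw [this]; linarith
  · refine l3ce_inv_le (by positivity) h1 ?_
    have : (R⁻¹ ^ 3 / 2)⁻¹ = 2 * R ^ 3 := by field_simp
    rw [this]; linarith
  · refine l3ce_inv_le (by positivity) h5 ?_
    have : (R⁻¹ / (2 * K))⁻¹ = 2 * (K * R) := by field_simp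
    rw [this]; linarith
  · have s1 := l3ce_sqrt_le hA0.le
    have s2 := l3ce_sqrt_le hr0.le
    have s3 := l3ce_sqrt_le (by positivity : (0:ℝ) ≤ 3 / 2 * r / θ)
    have hB' := hBle (9 / 2 * b) (by positivity) le_rfl
    linarith

/-- The absorbing constant `b = (1 + C_b)(1 + K + K⁻¹) R (1 + λ⁻¹)` dominates the elementary
combinations of `C_b, K, R, λ⁻¹` met below. [folklore] -/
theorem level3_envelope_absorb {Cb K R lam b : ℝ} (hCb : 0 ≤ Cb) (hK : 0 < K) (hR : 1 ≤ R) (hlam : 0 < lam)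
    (hb : b = (1 + Cb) * (1 + K + K⁻¹) * R * (1 + lam⁻¹)) :
    1 ≤ b ∧ R ≤ b ∧ K * R ≤ b ∧ R / K ≤ b ∧ Cb * R * lam⁻¹ ≤ b ∧
      Cb * lam⁻¹ * (R ^ 2 * (1 + K + K⁻¹)) ≤ b ^ 2 ∧ R + Cb / lam ≤ 2 * b ^ 2 ∧
      1 + 2 * b ^ 2 ≤ 3 * b ^ 2 ∧ 16 * b ^ 3 ≤ 4 * (2 * b ^ 2) ^ 2 ∧ R ≤ 2 * b ^ 2 := by
  have hKi : 0 < K⁻¹ := inv_pos.2 hK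
  have hli : 0 < lam⁻¹ := inv_pos.2 hlam
  have hR0 : 0 ≤ R := by linarith
  set Q := 1 + K + K⁻¹ with hQ
  have hQ1 : 1 ≤ Q := by rw [hQ]; linarith
  have hPQ : Q ≤ (1 + Cb) * Q := le_mul_of_one_le_left (by linarith) (by linarith)
  -- the basic comparison `X * R * Y ≤ b` for `X ≤ (1+Cb)Q`, `0 ≤ Y ≤ 1 + lam⁻¹`
  have key : ∀ X Y : ℝ, 0 ≤ X → X ≤ (1 + Cb) * Q → 0 ≤ Y → Y ≤ 1 + lam⁻¹ → X * R * Y ≤ b := by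
    intro X Y hX0 hX hY0 hY
    rw [hb]
    exact mul_le_mul (mul_le_mul_of_nonneg_right hX hR0) hY hY0 (by positivity)
  have hRb : R ≤ b := by
    have h := key 1 1 zero_le_one (le_trans hQ1 hPQ) zero_le_one (by linarith)
    simpa using h
  have hb1 : 1 ≤ b := hR.trans hRb
  have hKR : K * R ≤ b := by
    have h := key K 1 hK.le ((by rw [hQ]; linarith : K ≤ Q).trans hPQ) zero_le_one (by linarith)
    simpa using h
  have hRK : R / K ≤ b := by
    have h := key K⁻¹ 1 hKi.le ((by rw [hQ]; linarith : K⁻¹ ≤ Q).trans hPQ) zero_le_one (by linarith)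
    rw [div_eq_mul_inv, mul_comm]
    simpa using h
  have hC1 : Cb * R * lam⁻¹ ≤ b :=
    key Cb lam⁻¹ hCb ((le_mul_of_one_le_right hCb hQ1).trans
      (mul_le_mul_of_nonneg_right (by linarith) (by linarith))) hli.le (by linarith)
  have hC2 : Cb * lam⁻¹ * (R ^ 2 * (1 + K + K⁻¹)) ≤ b ^ 2 := by
    have h : Cb * Q * R * lam⁻¹ ≤ b :=
      key (Cb * Q) lam⁻¹ (by positivity) (mul_le_mul_of_nonneg_right (by linarith) (by linarith))
        hli.le (by linarith)
    calc Cb * lam⁻¹ * (R ^ 2 * (1 + K + K⁻¹)) = (Cb * Q * R * lam⁻¹) * R := by rw [hQ]; ring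
      _ ≤ b * b := mul_le_mul h hRb hR0 (by linarith)
      _ = b ^ 2 := by ring
  have hbb : b ≤ b ^ 2 := by nlinarith
  have hC3 : Cb / lam ≤ b := by
    rw [div_eq_mul_inv]
    calc Cb * lam⁻¹ = Cb * 1 * lam⁻¹ := by ring
      _ ≤ Cb * R * lam⁻¹ := by gcongr
      _ ≤ b := hC1
  have hb3 : b ^ 3 ≤ b ^ 4 := pow_le_pow_right₀ hb1 (by norm_num)
  refine ⟨hb1, hRb, hKR, hRK, hC1, hC2, by linarith, by nlinarith, by nlinarith, by linarith⟩

/-- Division step of the equation-of-state bounds: `|r^k · r · w| ≤ cZ (r s₃)` gives `|w| ≤ cZ s₃ U³`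
for `r⁻¹ ≤ U`, `1 ≤ U`, `k ≤ 3`. [folklore] -/
private theorem l3ce_eos_aux {r U cZ s3 w p : ℝ} {k : ℕ} (hr : 0 < r) (hrU : r⁻¹ ≤ U) (hU : 1 ≤ U)
    (he : 0 ≤ cZ * s3) (hk : k ≤ 3) (hp : r ^ k * r = p) (h : |p * w| ≤ cZ * (r * s3)) :
    |w| ≤ cZ * s3 * U ^ 3 := by
  rw [← hp, abs_mul, abs_of_pos (mul_pos (pow_pos hr _) hr), mul_right_comm,
    show cZ * (r * s3) = cZ * s3 * r by ring] at h
  have h1 : r ^ k * |w| ≤ cZ * s3 := le_of_mul_le_mul_right h hr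
  have h2 : |w| ≤ cZ * s3 * r⁻¹ ^ k := by
    have e1 : |w| = r⁻¹ ^ k * (r ^ k * |w|) := by
      rw [← mul_assoc, ← mul_pow, inv_mul_cancel₀ hr.ne', one_pow, one_mul]
    rw [e1, mul_comm (cZ * s3)]
    exact mul_le_mul_of_nonneg_left h1 (by positivity)
  have h3 : r⁻¹ ^ k ≤ U ^ 3 :=
    (pow_le_pow_left₀ (inv_nonneg.2 hr.le) hrU k).trans (pow_le_pow_right₀ hU hk)
  exact h2.trans (mul_le_mul_of_nonneg_left h3 he)

/-- Uniform scalar facts at a point of the weak regime, in terms of `U = 2b²`: the density window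
`[U⁻¹, U]`, `|θ| ≤ U`, first derivatives `≤ U`, the equation-of-state sizes `≤ cZ σ³ U³`, and
`cZ σ³ ≤ U/8`. [folklore] -/
theorem level3_envelope_point :
    ∀ {K R b U Cb lam cZ s3 c r₁ t₁ r θ z₀ z₁ z₂ z₃ z₄ : ℝ} {dr dr₁ dθ dθ₁ : Fin 3 → ℝ},
      0 < K → 1 ≤ R → 0 ≤ Cb → 0 < lam → 0 ≤ cZ → 0 ≤ s3 → 0 < c → c ≤ R → r₁ = c ^ 3 →
      Real.sqrt t₁ = Real.sqrt K * c → R⁻¹ ≤ r₁ → r₁ ≤ R → 0 ≤ t₁ → t₁ ≤ R →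
      |r - r₁| ≤ r₁ / 2 → |θ - t₁| ≤ t₁ / 2 → r * s3 * (cZ + 1) ≤ 1 / 8 →
      |z₀ - 1| ≤ cZ * (r * s3) → |r * z₁| ≤ cZ * (r * s3) → |r ^ 2 * z₂| ≤ cZ * (r * s3) →
      |r ^ 3 * z₃| ≤ cZ * (r * s3) → |r ^ 4 * z₄| ≤ cZ * (r * s3) →
      (∀ i, |dr₁ i| ≤ R) → (∀ i, |dθ₁ i| ≤ R) →
      (∀ i, Real.sqrt t₁ * |dr i - dr₁ i| / r₁ ≤ Cb / lam) →
      (∀ i, |dθ i - dθ₁ i| / Real.sqrt t₁ ≤ Cb / lam) →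
      R ≤ b → Cb * R * lam⁻¹ ≤ b → Cb * lam⁻¹ * (R ^ 2 * (1 + K + K⁻¹)) ≤ b ^ 2 → U = 2 * b ^ 2 →
      (U⁻¹ ≤ r ∧ r ≤ U) ∧ |θ| ≤ U ∧ (∀ i, |dr i| ≤ U) ∧ (∀ i, |dθ i| ≤ U) ∧
      (|z₀ - 1| ≤ cZ * s3 * U ^ 3 ∧ |z₁| ≤ cZ * s3 * U ^ 3 ∧ |z₂| ≤ cZ * s3 * U ^ 3 ∧
        |z₃| ≤ cZ * s3 * U ^ 3 ∧ |z₄| ≤ cZ * s3 * U ^ 3) ∧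
      cZ * s3 ≤ U / 8 := by
  intro K R b U Cb lam cZ s3 c r₁ t₁ r θ z₀ z₁ z₂ z₃ z₄ dr dr₁ dθ dθ₁ hK hR hCb hlam hcZ hs3 hc0 hcu hr₁ hsq hr₁l hr₁R
    ht₁0 ht₁R hδr hδt hpack hE0 hE1 hE2 hE3 hE4 hdr₁ hdθ₁ hB1r hB1θ hbR hb2 hb3 hU
  have hR0 : 0 < R := by linarith
  have hb1 : 1 ≤ b := hR.trans hbR
  have hbb : b ≤ b ^ 2 := by nlinarith
  have hRb2 : R ≤ b ^ 2 := hbR.trans hbb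
  have hU1 : 1 ≤ U := by rw [hU]; nlinarith
  have hU0 : 0 < U := by linarith
  -- density window
  have hr1 : r₁ / 2 ≤ r := by linarith [(abs_le.1 hδr).1]
  have hr2 : r ≤ 3 / 2 * r₁ := by linarith [(abs_le.1 hδr).2]
  have hr₁0 : 0 < r₁ := lt_of_lt_of_le (inv_pos.2 hR0) hr₁l
  have hr0 : 0 < r := by linarith
  have hrU : r ≤ U := by rw [hU]; linarith
  have hUr : U⁻¹ ≤ r := by
    have h1 : (b ^ 2)⁻¹ ≤ R⁻¹ := inv_anti₀ hR0 hRb2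
    have h2 : U⁻¹ = (b ^ 2)⁻¹ / 2 := by rw [hU, mul_inv]; ring
    rw [h2]
    linarith
  have hrinv : r⁻¹ ≤ U := by
    have h := inv_anti₀ (inv_pos.2 hU0) hUr
    rwa [inv_inv] at h
  -- temperature
  have hθ1 : t₁ / 2 ≤ θ := by linarith [(abs_le.1 hδt).1]
  have hθ2 : θ ≤ 3 / 2 * t₁ := by linarith [(abs_le.1 hδt).2]
  have hθU : |θ| ≤ U := by
    rw [abs_of_nonneg (by linarith), hU]; linarith
  -- first derivatives of the density
  have hsK : 0 < Real.sqrt K := Real.sqrt_pos.2 hK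
  have hKc : 0 < Real.sqrt K * c := mul_pos hsK hc0
  have hsqK := (l3ce_sqrtK hK).1
  have hdr : ∀ i, |dr i| ≤ U := fun i => by
    have h := hB1r i
    rw [div_le_iff₀ hr₁0, hsq, hr₁] at h
    have hd : |dr i - dr₁ i| ≤ Cb / lam * c ^ 3 / (Real.sqrt K * c) := by
      rw [le_div_iff₀ hKc, mul_comm]; exact h
    have e : Cb / lam * c ^ 3 / (Real.sqrt K * c) = Cb * lam⁻¹ * (c ^ 2 * (Real.sqrt K)⁻¹) := by
      field_simp
    rw [e] at hd
    have hc2 : c ^ 2 * (Real.sqrt K)⁻¹ ≤ R ^ 2 * (1 + K + K⁻¹) :=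
      mul_le_mul (pow_le_pow_left₀ hc0.le hcu 2) hsqK (by positivity) (by positivity)
    have hd' : |dr i - dr₁ i| ≤ b ^ 2 :=
      (hd.trans (mul_le_mul_of_nonneg_left hc2 (by positivity))).trans hb3
    have ht := abs_add_le (dr₁ i) (dr i - dr₁ i)
    rw [add_sub_cancel] at ht
    rw [hU]; linarith [hdr₁ i]
  -- first derivatives of the temperature
  have hst : 0 < Real.sqrt t₁ := by rw [hsq]; exact hKc
  have hst1 : Real.sqrt t₁ ≤ R :=
    (Real.sqrt_le_sqrt (ht₁R.trans (by nlinarith))).trans_eq (Real.sqrt_sq hR0.le)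
  have hdθ : ∀ i, |dθ i| ≤ U := fun i => by
    have h := hB1θ i
    rw [div_le_iff₀ hst] at h
    have hd' : |dθ i - dθ₁ i| ≤ b := by
      refine h.trans (le_trans ?_ hb2)
      rw [div_eq_mul_inv, mul_right_comm]
      exact mul_le_mul_of_nonneg_right (mul_le_mul_of_nonneg_left hst1 hCb) (inv_pos.2 hlam).le
    have ht := abs_add_le (dθ₁ i) (dθ i - dθ₁ i)
    rw [add_sub_cancel] at ht
    rw [hU]; linarith [hdθ₁ i]
  -- equation of state
  have hε0 : 0 ≤ cZ * s3 := mul_nonneg hcZ hs3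
  have hεr : cZ * s3 * r ≤ 1 / 8 := by
    have e : r * s3 * (cZ + 1) = cZ * s3 * r + r * s3 := by ring
    rw [e] at hpack
    linarith [mul_nonneg hr0.le hs3]
  have hε : cZ * s3 ≤ U / 8 := by
    have h2 : cZ * s3 ≤ 1 / 8 * r⁻¹ := by
      rw [← div_eq_mul_inv, le_div_iff₀ hr0]; exact hεr
    linarith
  have hU3 : U ≤ U ^ 3 := le_self_pow₀ hU1 (by norm_num)
  have hz0 : |z₀ - 1| ≤ cZ * s3 * U ^ 3 := by
    refine hE0.trans ?_
    calc cZ * (r * s3) = cZ * s3 * r := by ring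
      _ ≤ cZ * s3 * U ^ 3 := mul_le_mul_of_nonneg_left (hrU.trans hU3) hε0
  refine ⟨⟨hUr, hrU⟩, hθU, hdr, hdθ, ⟨hz0, ?_, ?_, ?_, ?_⟩, hε⟩
  · exact l3ce_eos_aux (k := 0) hr0 hrinv hU1 hε0 (by norm_num) (by ring) hE1
  · exact l3ce_eos_aux (k := 1) hr0 hrinv hU1 hε0 (by norm_num) (by ring) hE2
  · exact l3ce_eos_aux (k := 2) hr0 hrinv hU1 hε0 (by norm_num) (by ring) hE3
  · exact l3ce_eos_aux (k := 3) hr0 hrinv hU1 hε0 le_rfl (by ring) hE4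

/-- The explicit constants of the atoms and of their products are dominated by `Mv`, the small ones by
`(cZ σ³) Mv`, once `2¹⁸ (1 + U)¹⁶ ≤ Mv`. [folklore] -/
theorem level3_envelope_consts {U R e z Mv : ℝ} (hU : 1 ≤ U) (hR : 0 ≤ R) (hRU : R ≤ U) (he : 0 ≤ e)
    (heU : e ≤ U / 8) (hz : z = e * U ^ 3) (hMv : 2 ^ 18 * (1 + U) ^ 16 ≤ Mv) :
    ∀ Cζ Cζ1 Cinv : ℝ, Cζ = (1 + z + z + z + z) * (1 + U) ^ 3 → Cζ1 = (z + z + z + z) * (1 + U) ^ 3 →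
      Cinv = 6 * (1 + U⁻¹⁻¹) ^ 4 * (1 + U) ^ 3 →
      1 + U + U ≤ Mv ∧
      8 * (8 * (1 + U + U) * (Cζ + 8 * (1 + U + U) * Cζ1)) * Cinv ≤ Mv ∧
      Cζ ≤ Mv ∧
      8 * (1 + U + U) * Cζ ≤ Mv ∧
      R + R + R ≤ Mv ∧
      R ≤ Mv ∧
      8 * (8 * (Cζ + 8 * (1 + U + U) * Cζ1) * Cinv) * R ≤ Mv ∧
      8 * (8 * (8 * R * Cinv) * R) * R ≤ Mv ∧
      8 * Cζ * (R + R + R) ≤ Mv ∧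
      1 ≤ Mv ∧ U ≤ Mv ∧ 4 * U ^ 2 ≤ Mv ∧
      8 * (8 * (8 * R * (Cζ1 + 8 * (1 + U + U) * Cζ1)) * Cinv) * R + 8 * Cζ1 * R ≤ e * Mv ∧
      8 * (|2 / 3| * (8 * R * Cζ1)) * (R + R + R) ≤ e * Mv := by
  intro Cζ Cζ1 Cinv hCζ hCζ1 hCinv
  rw [inv_inv] at hCinv
  have hU0 : 0 ≤ U := by linarith
  have hz0 : 0 ≤ z := by rw [hz]; positivity
  have h4z : z + z + z + z ≤ U ^ 4 / 2 := by
    have h1 : e * U ^ 3 ≤ U / 8 * U ^ 3 := mul_le_mul_of_nonneg_right heU (by positivity)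
    have h2 : U / 8 * U ^ 3 = U ^ 4 / 8 := by ring
    rw [hz]; linarith
  set W := 1 + U with hW
  have hW1 : 1 ≤ W := by linarith
  have hW0 : 0 ≤ W := by linarith
  have hUW : U ≤ W := by linarith
  have hRW : R ≤ W := hRU.trans hUW
  have h2U : W + U ≤ 2 * W := by linarith
  have hWp : ∀ {m n : ℕ}, m ≤ n → W ^ m ≤ W ^ n := fun h => pow_le_pow_right₀ hW1 h
  have hW16 : W ≤ W ^ 16 := le_self_pow₀ hW1 (by norm_num)
  have hW16' : 0 ≤ W ^ 16 := by positivity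
  have hMv' : W ^ 16 ≤ Mv := by linarith
  -- `1 + 4z ≤ W⁴`
  have hW4 : 1 + U ^ 4 ≤ W ^ 4 := by
    have e1 : W ^ 4 = 1 + U ^ 4 + (4 * U + 6 * U ^ 2 + 4 * U ^ 3) := by rw [hW]; ring
    rw [e1]; linarith [(by positivity : (0 : ℝ) ≤ 4 * U + 6 * U ^ 2 + 4 * U ^ 3)]
  have hzW : z + z + z + z ≤ W ^ 4 := by linarith [pow_nonneg hU0 4]
  have h1zW : 1 + z + z + z + z ≤ W ^ 4 := by linarith [pow_nonneg hU0 4]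
  -- the atoms
  have hCζ0 : 0 ≤ Cζ := by rw [hCζ]; positivity
  have hCζ10 : 0 ≤ Cζ1 := by rw [hCζ1]; positivity
  have hCinv0 : 0 ≤ Cinv := by rw [hCinv]; positivity
  have hCζW : Cζ ≤ W ^ 7 := by
    rw [hCζ]
    calc (1 + z + z + z + z) * W ^ 3 ≤ W ^ 4 * W ^ 3 := mul_le_mul_of_nonneg_right h1zW (by positivity)
      _ = W ^ 7 := by ring
  have hCinvW : Cinv ≤ 6 * W ^ 7 := by rw [hCinv]; apply le_of_eq; ring
  have hCγ : Cζ + 8 * (W + U) * Cζ1 ≤ 17 * W ^ 8 := by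
    have h1 : Cζ1 ≤ W ^ 7 := by
      rw [hCζ1]
      calc (z + z + z + z) * W ^ 3 ≤ W ^ 4 * W ^ 3 := mul_le_mul_of_nonneg_right hzW (by positivity)
        _ = W ^ 7 := by ring
    calc Cζ + 8 * (W + U) * Cζ1 ≤ W ^ 7 + 8 * (2 * W) * W ^ 7 := by gcongr
      _ = W ^ 7 + 16 * W ^ 8 := by ring
      _ ≤ W ^ 8 + 16 * W ^ 8 := by linarith [hWp (show 7 ≤ 8 by norm_num)]
      _ = 17 * W ^ 8 := by ring
  have hCγ0 : 0 ≤ Cζ + 8 * (W + U) * Cζ1 := by positivity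
  -- small atoms
  have hCζ1e : Cζ1 ≤ 4 * z * W ^ 3 := by rw [hCζ1]; apply le_of_eq; ring
  have hCγ1 : Cζ1 + 8 * (W + U) * Cζ1 ≤ 68 * z * W ^ 4 := by
    have h34 : z * W ^ 3 ≤ z * W ^ 4 := mul_le_mul_of_nonneg_left (hWp (by norm_num)) hz0
    calc Cζ1 + 8 * (W + U) * Cζ1 ≤ 4 * z * W ^ 3 + 8 * (2 * W) * (4 * z * W ^ 3) := by gcongr
      _ = 4 * (z * W ^ 3) + 64 * (z * W ^ 4) := by ring
      _ ≤ 4 * (z * W ^ 4) + 64 * (z * W ^ 4) := by linarith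
      _ = 68 * z * W ^ 4 := by ring
  have hzU : z * W ^ 13 ≤ e * W ^ 16 := by
    rw [hz]
    calc e * U ^ 3 * W ^ 13 = e * (U ^ 3 * W ^ 13) := by ring
      _ ≤ e * (W ^ 3 * W ^ 13) :=
          mul_le_mul_of_nonneg_left (mul_le_mul_of_nonneg_right (pow_le_pow_left₀ hU0 hUW 3) (by positivity)) he
      _ = e * W ^ 16 := by ring
  have heMv : e * (2 ^ 18 * W ^ 16) ≤ e * Mv := mul_le_mul_of_nonneg_left hMv he
  have heW : e * (2 ^ 18 * W ^ 16) = 262144 * (e * W ^ 16) := by ring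
  refine ⟨?_, ?_, ?_, ?_, ?_, ?_, ?_, ?_, ?_, ?_, ?_, ?_, ?_, ?_⟩
  · linarith
  · calc 8 * (8 * (W + U) * (Cζ + 8 * (W + U) * Cζ1)) * Cinv
          ≤ 8 * (8 * (2 * W) * (17 * W ^ 8)) * (6 * W ^ 7) := by gcongr
      _ = 13056 * W ^ 16 := by ring
      _ ≤ Mv := by linarith
  · linarith [hWp (show 7 ≤ 16 by norm_num)]
  · calc 8 * (W + U) * Cζ ≤ 8 * (2 * W) * W ^ 7 := by gcongr
      _ = 16 * W ^ 8 := by ring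
      _ ≤ Mv := by linarith [hWp (show 8 ≤ 16 by norm_num)]
  · linarith
  · linarith
  · calc 8 * (8 * (Cζ + 8 * (W + U) * Cζ1) * Cinv) * R ≤ 8 * (8 * (17 * W ^ 8) * (6 * W ^ 7)) * W := by gcongr
      _ = 6528 * W ^ 16 := by ring
      _ ≤ Mv := by linarith
  · calc 8 * (8 * (8 * R * Cinv) * R) * R ≤ 8 * (8 * (8 * W * (6 * W ^ 7)) * W) * W := by gcongr
      _ = 3072 * W ^ 10 := by ring
      _ ≤ Mv := by linarith [hWp (show 10 ≤ 16 by norm_num)]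
  · calc 8 * Cζ * (R + R + R) ≤ 8 * W ^ 7 * (W + W + W) := by gcongr
      _ = 24 * W ^ 8 := by ring
      _ ≤ Mv := by linarith [hWp (show 8 ≤ 16 by norm_num)]
  · linarith
  · linarith
  · linarith [hWp (show 2 ≤ 16 by norm_num), pow_le_pow_left₀ hU0 hUW 2]
  · calc 8 * (8 * (8 * R * (Cζ1 + 8 * (W + U) * Cζ1)) * Cinv) * R + 8 * Cζ1 * R
          ≤ 8 * (8 * (8 * W * (68 * z * W ^ 4)) * (6 * W ^ 7)) * W + 8 * (4 * z * W ^ 3) * W := by gcongr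
      _ = 208896 * (z * W ^ 13) + 32 * (z * W ^ 4) := by ring
      _ ≤ 208896 * (z * W ^ 13) + 32 * (z * W ^ 13) := by
          linarith [mul_le_mul_of_nonneg_left (hWp (show 4 ≤ 13 by norm_num)) hz0]
      _ ≤ 208928 * (e * W ^ 16) := by linarith
      _ ≤ e * (2 ^ 18 * W ^ 16) := by rw [heW]; linarith [mul_nonneg he hW16']
      _ ≤ e * Mv := heMv
  · rw [abs_of_pos (by norm_num : (0 : ℝ) < 2 / 3)]
    calc 8 * (2 / 3 * (8 * R * Cζ1)) * (R + R + R) ≤ 8 * (2 / 3 * (8 * W * (4 * z * W ^ 3))) * (W + W + W) := by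
            gcongr
      _ = 512 * (z * W ^ 5) := by ring
      _ ≤ 512 * (z * W ^ 13) := by linarith [mul_le_mul_of_nonneg_left (hWp (show 5 ≤ 13 by norm_num)) hz0]
      _ ≤ 512 * (e * W ^ 16) := by linarith
      _ ≤ e * (2 ^ 18 * W ^ 16) := by rw [heW]; linarith [mul_nonneg he hW16']
      _ ≤ e * Mv := heMv

end Summit.AtomisticToContinuum.HydrodynamicLimit.Theorems

end
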